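import Summits.RiemannHypothesis.RiemannHypothesis.Theorems.WeilParityEvenWinsBeyondArchFrontierCell7OfBlocks
import Summits.RiemannHypothesis.RiemannHypothesis.Theorems.GroundBartaEvenWinsBeyondArchDeflationEndpoint7Consts
import HarnessLib

/-!
# RiemannHypothesis / GroundBarta — rung 4 beyond `83/100`: Weil positivity on the CLOSED four-prime window `[-(log 7)/2, (log 7)/2]`
# from the two sector blocks at the endpoint (the contract of LADDER rung W-M3)

Helper file (`--supports stmt-RiemannHypothesis-18085`), RH-free, pure logic (prover B g8; the `(log 7)/2` twin of prover A g10/g11's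
`…FrontierLog5HalfOfBlocks` / `…FrontierCell7OfBlocks`).  The window `a* = (log 7)/2` is the far end of the band on which exactly the prime
powers `2, 3, 4, 5` are visible (`7` enters at `a*`); it is irrational, so the blocks there are an ENDPOINT CELL (cut trial vectors at the convergent
`c″ < a*`, images extended to `b″ > a*`, thin shell `5.7·10⁻³⁸`: `…DeflationEndpoint7Consts`, `…Endpoint7ShellConsts`, bridge
`dt_weil{Odd,Even}GroundEnergy_ge_of_deflCert_wxa45` with `c = Real.log 7 / 2`; design note `DESIGN-ENDPOINT-LOG7HALF.md` of unit `sr-gb-rung-b`).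
This file states what the two blocks deliver:

* `weilPositivityOn_log7half_of_blocks` — `0 ≤ ε_ev((log 7)/2)` and `0 ≤ ε_od((log 7)/2)` give `WeilPositivityOn (Real.log 7 / 2)`: Weil positivity for
  every test function supported in `[-(log 7)/2, (log 7)/2]` (`e^{2a*} = 7`), hence (`weilPositivityOn_of_le_log7half_of_blocks`) on every smaller window —
  superseding `83/100`, `(log 5)/2`, `4023/5000`, …;
* `weilGroundEnergy_log7half_nonneg_of_blocks` — the bottom of the form on that window is `≥ 0`.
-/

set_option linter.dupNamespace false

noncomputable section

open Set MeasureTheory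

namespace Summit.RiemannHypothesis.RiemannHypothesis.Theorems.EvenWinsBeyondArch

open Literature.NumberTheory.LFunctions

/-- **Weil positivity on `[-(log 7)/2, (log 7)/2]` from the two endpoint blocks**: `0 ≤ ε_ev((log 7)/2)` and `0 ≤ ε_od((log 7)/2)` give
`WeilPositivityOn (Real.log 7 / 2)`. [folklore] -/
theorem weilPositivityOn_log7half_of_blocks (hE : 0 ≤ weilEvenGroundEnergy (Real.log 7 / 2))
    (hO : 0 ≤ weilOddGroundEnergy (Real.log 7 / 2)) : WeilPositivityOn (Real.log 7 / 2) :=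
  dt_weilPositivityOn hE hO

/-- The bottom of Weil's form on `[-(log 7)/2, (log 7)/2]` is non-negative, from the two blocks. [folklore] -/
theorem weilGroundEnergy_log7half_nonneg_of_blocks (hE : 0 ≤ weilEvenGroundEnergy (Real.log 7 / 2))
    (hO : 0 ≤ weilOddGroundEnergy (Real.log 7 / 2)) : 0 ≤ weilGroundEnergy (Real.log 7 / 2) := by
  rw [weilGroundEnergy_eq_min_even_odd]
  exact le_min hE hO

/-- Weil positivity on every window `a ≤ (log 7)/2`, from the two endpoint blocks. [folklore] -/
theorem weilPositivityOn_of_le_log7half_of_blocks (hE : 0 ≤ weilEvenGroundEnergy (Real.log 7 / 2))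
    (hO : 0 ≤ weilOddGroundEnergy (Real.log 7 / 2)) {a : ℝ} (ha : a ≤ Real.log 7 / 2) : WeilPositivityOn a :=
  (weilPositivityOn_log7half_of_blocks hE hO).mono ha

/-- In particular the endpoint blocks re-prove the `83/100` rung (`83/100 < (log 7)/2`, `dt_e7_83_lt_log7half`). [folklore] -/
theorem weilPositivityOn_83_of_log7half_blocks (hE : 0 ≤ weilEvenGroundEnergy (Real.log 7 / 2))
    (hO : 0 ≤ weilOddGroundEnergy (Real.log 7 / 2)) : WeilPositivityOn (83 / 100) :=
  weilPositivityOn_of_le_log7half_of_blocks hE hO dt_e7_83_lt_log7half.le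

/-- Conversely, by antitonicity of the sector bottoms in the window, the endpoint blocks are the STRONGEST statement of the band:
`0 ≤ ε_ev((log 7)/2)` gives `0 ≤ ε_ev(a)` for every `0 < a ≤ (log 7)/2` (and likewise odd). [folklore] -/
theorem weilEvenGroundEnergy_nonneg_of_le_log7half (hE : 0 ≤ weilEvenGroundEnergy (Real.log 7 / 2)) {a : ℝ}
    (ha : a ≤ Real.log 7 / 2) : 0 ≤ weilEvenGroundEnergy a := by
  rcases le_or_gt a 0 with h0 | h0
  · rw [weilEvenGroundEnergy_of_nonpos h0]
  · exact hE.trans (weilEvenGroundEnergy_antitone h0 ha)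

end Summit.RiemannHypothesis.RiemannHypothesis.Theorems.EvenWinsBeyondArch

end
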